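import Literature.MathematicalPhysics.QuantumFieldTheory.ContinuumLimitsTrivialityReductionsProofs
import Literature.Probability.LatticeModels.HighDimTrivialityPanisFourHolds
import HarnessLib

/-!
# Discharges of named facts of `ContinuumLimits.lean`

`Literature/MathematicalPhysics/QuantumFieldTheory/ContinuumLimitsHolds.lean` — proofs-only
sibling of `ContinuumLimits.lean` (no definitions, no named facts). Each theorem below closes
a named fact `X : Prop` of that file as `X_holds : X` by composing an ACCEPTED reduction
theorem of the tree with the ACCEPTED unconditional `_holds` discharges of all of its
hypotheses; nothing is re-proved and no statement is changed. Recorded by the librarian sweep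
g25 (2026-08-16, pass 5c: facts dischargeable in one line from the tree's own lemmas), so that
the facts census, `#h21_route_deps` and the cone guardrail see these facts as theorems.

Discharged here:

* `ising4_triviality_holds` := `ising4_triviality_of_panisFour`
  `panis_ursellFourSum_le_four_holds` (`ContinuumLimitsTrivialityReductionsProofs.lean`).

## References

* [AizenmanDuminilCopinAnnals2021] — see `lean/references.bib` and the docstring of the fact in `ContinuumLimits.lean`.
-/

namespace Literature.MathematicalPhysics.QuantumFieldTheory

/-- **Discharge of the named fact `ising4_triviality`** (`ContinuumLimits.lean`):
constructive-qft.S24 (marginal triviality of Ising₄; Aizenman–Duminil-Copin, Ann. Math. 194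
(2021) 163, arXiv:1912.07973, Thm 1.2 with Def. 1.1, §1.3 and Prop. 1.4; known theorem;
restated 2026-08-15 in the printed regime — defact verdict `misstated`: … — obtained as
`ising4_triviality_of_panisFour` applied to the tree's unconditional discharge
`panis_ursellFourSum_le_four_holds` of its hypothesis (reduction in
`ContinuumLimitsTrivialityReductionsProofs.lean`).
[cite: AizenmanDuminilCopinAnnals2021, Thm 1.2 (p. 4) with Def. 1.1 (p. 4), §1.3 (p. 5, Ising case) and Prop. 1.4 (p. 6: β ≤ β_c, L ≤ ξ(β)); centring §6.3 (p. 26)] -/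
theorem ising4_triviality_holds :
    ising4_triviality :=
  ising4_triviality_of_panisFour
    Literature.Probability.LatticeModels.panis_ursellFourSum_le_four_holds

end Literature.MathematicalPhysics.QuantumFieldTheory
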